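import Summits.HodgeConjecture.HodgeConjecture.Theses.NikulinTwinTransport
import Literature.AlgebraicGeometry.Surfaces.K3SurfaceProofs
import Literature.AlgebraicGeometry.Surfaces.K3Marking
import Literature.AlgebraicGeometry.HodgeTheory.ComplexGysinOrientation
import Literature.AlgebraicGeometry.HodgeTheory.GysinKernelProofs

/-!
# Route NikulinTwinTransport · item `HodgeIsometryAlgebraic` (stmt-HodgeConjecture-13675) — what the
# item hinges on, by name, and at a single orientation family

The route item `HodgeIsometryAlgebraic` is, symbol for symbol, the body of the tree's named fact
`Literature.AlgebraicGeometry.Surfaces.Buskin2019_hodgeIsometry_algebraic` (Buskin, J. reine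
angew. Math. 755 (2019), Thm. 1.1; reproof Huybrechts, Comment. Math. Helv. 94 (2019), Thm. 0.2):
every rational, type-preserving, isometric `φ : H²(S′(ℂ); ℂ) → H²(S(ℂ); ℂ)` between projective K3
surfaces is `[γ]_*` for an algebraic class `γ` of codimension `2` on `S ⊗ S′`
(`hodgeIsometryAlgebraic_iff_buskin`, `Iff.rfl`). The fact is not discharged in the tree; the item
closes the day it is. This file records, kernel-checked and BY NAME, what that discharge still needs,
and removes one quantifier from it:

* `buskinAt_of_orientationFamily`, `hodgeIsometryAlgebraic_iff_buskinAt`: the statement quantifies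
  over all orientation families `μ` with Poincaré duality, but Poincaré duality is now a theorem of
  the tree for every family (`OrientationFamily.hasPoincareDuality`) and two families give
  proportional Gysin morphisms (`complexGysin_eq_smul_of_orientationFamily`, `c ≠ 0`), absorbed by
  the `ℂ`-submodule `algebraicClasses` (`γ ↦ c⁻¹ • γ`). So the item is EQUIVALENT to its instance
  at any one fixed family `μ₀` (e.g. the complex orientations), with no duality hypothesis.
* `buskinAt_of_reflective`, `hodgeIsometryAlgebraic_of_reflective`: Buskin's printed proof of
  Thm. 1.1 (§6.2, p. 22), assembled in the tree as
  `Literature.AlgebraicGeometry.Surfaces.Buskin2019_hodgeIsometry_algebraic_of_reflective`, yields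
  the item from FOUR inputs, here stated by name / at the single family `μ₀`:
  (h) `Huybrechts_K3_periodSurjective_projective` — surjectivity of the period map, projective form
  (named fact of the tree); (hmark) `Huybrechts_K3_marking_exists` — markings with projective
  periods of the given K3 surfaces (named fact of the tree; Huybrechts Ch. 1 Prop. 3.5);
  (hrefl) Buskin's Prop. 6.2 for REFLECTIVE rational Hodge isometries `η⁻¹ ∘ s_v ∘ η′` between
  marked projective K3 surfaces, AT `μ₀` ONLY — the heart of the paper (Mukai's moduli of sheaves,
  twistor lines, hyperholomorphic transport), not in the tree; (hcomp) his Lemma 6.3, composition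
  of algebraic correspondences between K3 surfaces, AT `μ₀` ONLY — formal debt (Gysin base change
  for product squares and algebraicity of the composite class; Fulton, *Intersection Theory* §16.1).
  The assembly re-runs the Literature proof at `μ₀` (signs of the generators of `H⁴` via
  `not_antiIsometry_k3Form`; Cartan–Dieudonné `exists_eq_prod_k3ReflectionC`; period compatibility
  from the preservation of type `(2,0)`; the chain `corr_prod_k3ReflectionC_of_reflective`) and then
  transports to every family.

Nothing here is a proof of the item: `hodgeIsometryAlgebraic_of_reflective` is conditional on
(h), (hmark) (named facts) and on the inline hypotheses (hrefl), (hcomp).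
-/

noncomputable section

open CategoryTheory MonoidalCategory
open Literature.AlgebraicGeometry.Motives Literature.AlgebraicGeometry.HodgeTheory
open Literature.AlgebraicGeometry.Surfaces
open Literature.AlgebraicTopology.SingularHomology

namespace Summit.HodgeConjecture.HodgeConjecture.Theorems.NikulinTwinTransport

/-- `BuskinAt[μ]`: the body of the item `HodgeIsometryAlgebraic` (= of the named fact
`Buskin2019_hodgeIsometry_algebraic`) AT ONE orientation family `μ`, without the Poincaré-duality
hypothesis (a theorem of the tree, `OrientationFamily.hasPoincareDuality`). Local notation only. -/
local notation3 (prettyPrint := false) "BuskinAt[" μ "]" =>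
  ∀ (S S' : SchemeOver ℂ) (hS : IsK3Surface S) (hS' : IsK3Surface S')
    (p : complexBetti S (2 * 2)) (p' : complexBetti S' (2 * 2)),
    (IsIntegralClass p ∧ ∀ q : complexBetti S (2 * 2), IsIntegralClass q → ∃ n : ℤ, q = n • p) →
    (IsIntegralClass p' ∧ ∀ q : complexBetti S' (2 * 2), IsIntegralClass q → ∃ n : ℤ, q = n • p') →
    ∀ (φ : complexBetti S' (2 * 1) →ₗ[ℂ] complexBetti S (2 * 1)),
      (∀ x, IsRationalClass x → IsRationalClass (φ x)) →
      (∀ (i j : ℕ) x, IsOfHodgeType 2 S' (2 * 1) i j x → IsOfHodgeType 2 S (2 * 1) i j (φ x)) →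
      (∀ (x y : complexBetti S' (2 * 1)) (a : ℂ),
          cupProduct (rfl : 2 * 1 + 2 * 1 = 2 * 2) x y = a • p' →
            cupProduct (rfl : 2 * 1 + 2 * 1 = 2 * 2) (φ x) (φ y) = a • p) →
      ∃ γ ∈ algebraicClasses (S ⊗ S') 2, ∀ x : complexBetti S' (2 * 1),
        φ x = complexGysin μ (IsSmoothProjective.tensor_holds hS.1 hS'.1) hS.1
          (SemiCartesianMonoidalCategory.fst S S')
          (rfl : 2 * 1 + 2 * 2 + 2 * 2 = 2 * 1 + 2 * (2 + 2))
          (cupProduct (rfl : 2 * 1 + 2 * 2 = 2 * 1 + 2 * 2)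
            (complexBetti.map (SemiCartesianMonoidalCategory.snd S S') (2 * 1) x) γ)

/-- `MarkedK3[S, η, p, x]`: a marked K3 surface with period `x`, in the exact shape of the
conclusion of `Huybrechts_K3_periodSurjective_projective` and of the marking clauses of
`Huybrechts_K3_marking_exists` (copied from `K3SurfaceProofs`). Local notation only. -/
local notation3 (prettyPrint := false) "MarkedK3[" S ", " η ", " p ", " x "]" =>
  (IsIntegralClass p ∧
    (∀ q : complexBetti S (2 * 2), IsIntegralClass q → ∃ n : ℤ, q = n • p) ∧
    (∀ c : complexBetti S (2 * 1), IsIntegralClass c ↔ ∃ v : K3Index → ℤ, η c = fun i => (v i : ℂ)) ∧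
    (∀ a b : complexBetti S (2 * 1),
        cupProduct (rfl : 2 * 1 + 2 * 1 = 2 * 2) a b = k3Form (η a) (η b) • p) ∧
    IsOfHodgeType 2 S (2 * 1) 2 0 (LinearEquiv.symm η x) ∧
    (∀ τ : complexBetti S (2 * 1), IsOfHodgeType 2 S (2 * 1) 2 0 τ → ∃ t : ℂ, τ = t • LinearEquiv.symm η x))

/-- `PeriodPt[x]`: `x ∈ Λ_ℂ` is a projective period point in the sense of the hypotheses of
`Huybrechts_K3_periodSurjective_projective` (copied from `K3SurfaceProofs`). Local notation only. -/
local notation3 (prettyPrint := false) "PeriodPt[" x "]" =>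
  (k3Form x x = 0 ∧ 0 < (k3Form (star x) x).re ∧
    ∃ u : K3Index → ℤ, k3Form (fun i => (u i : ℂ)) x = 0 ∧ 0 < ∑ i, ∑ j, u i * k3Gram i j * u j)

/-- `Corr[μ, S, S', hS, hS' ; γ, y] = [γ]_* y = fst_* (snd^* y ∪ γ)`: the action of a class `γ`
on `S ⊗ S'` as a correspondence from `S'` to `S`, literally the expression of the item's conclusion
(copied from `K3SurfaceProofs`). Local notation only. -/
local notation3 (prettyPrint := false) "Corr[" μ ", " S ", " S' ", " hS ", " hS' " ; " γ ", " y "]" =>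
  complexGysin μ
    (IsSmoothProjective.tensor_holds (IsK3Surface.isSmoothProjective hS)
      (IsK3Surface.isSmoothProjective hS'))
    (IsK3Surface.isSmoothProjective hS) (SemiCartesianMonoidalCategory.fst S S')
    (rfl : 2 * 1 + 2 * 2 + 2 * 2 = 2 * 1 + 2 * (2 + 2))
    (cupProduct (rfl : 2 * 1 + 2 * 2 = 2 * 1 + 2 * 2)
      (complexBetti.map (SemiCartesianMonoidalCategory.snd S S') (2 * 1) y) γ)

/-! ### The item is the named fact -/

/-- **The route item `HodgeIsometryAlgebraic` is, verbatim, the tree's named fact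
`Buskin2019_hodgeIsometry_algebraic`** (Buskin 2019, Thm. 1.1; the route file unfolds `IsK3Surface`
to its body, `isK3Surface_iff` being `Iff.rfl`). [cite: Buskin2019, Thm. 1.1] -/
theorem hodgeIsometryAlgebraic_iff_buskin :
    Theses.NikulinTwinTransport.HodgeIsometryAlgebraic ↔ Buskin2019_hodgeIsometry_algebraic :=
  Iff.rfl

/-! ### Orientation families: one family suffices, Poincaré duality is free -/

/-- **Independence of the orientation family.** If Buskin's statement holds at one orientation
family `μ₀`, it holds at every `μ`: `complexGysin μ = c • complexGysin μ₀` with `c ≠ 0`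
(`complexGysin_eq_smul_of_orientationFamily`; both families have Poincaré duality by
`OrientationFamily.hasPoincareDuality`), and `γ ↦ c⁻¹ • γ` preserves `algebraicClasses`.
[cite: FultonYoungTableaux1997, Appendix B §B.1 (5)] -/
theorem buskinAt_of_orientationFamily {μ₀ : OrientationFamily} (μ : OrientationFamily)
    (h : BuskinAt[μ₀]) : BuskinAt[μ] := by
  intro S S' hS hS' p p' hp hp' φ hrat htype hiso
  obtain ⟨γ, hγ, hγeq⟩ := h S S' hS hS' p p' hp hp' φ hrat htype hiso
  obtain ⟨c, hc, hcμ⟩ := complexGysin_eq_smul_of_orientationFamily μ₀.hasPoincareDuality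
    μ.hasPoincareDuality (IsSmoothProjective.tensor_holds hS.1 hS'.1) hS.1
    (SemiCartesianMonoidalCategory.fst S S') (rfl : 2 * 1 + 2 * 2 + 2 * 2 = 2 * 1 + 2 * (2 + 2))
  refine ⟨c⁻¹ • γ, Submodule.smul_mem _ _ hγ, fun x => ?_⟩
  rw [hcμ]
  simp only [LinearMap.smul_apply, map_smul, smul_smul, inv_mul_cancel₀ hc, one_smul]
  exact hγeq x

/-- **The item from its instance at one orientation family** (the duality hypothesis of the item is
discarded: it is a theorem). [cite: Buskin2019, Thm. 1.1] -/
theorem hodgeIsometryAlgebraic_of_buskinAt (μ₀ : OrientationFamily) (h : BuskinAt[μ₀]) :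
    Theses.NikulinTwinTransport.HodgeIsometryAlgebraic := by
  intro μ _ S S' hS hS' p p' hp hp' φ hrat htype hiso
  exact buskinAt_of_orientationFamily μ h S S' hS hS' p p' hp hp' φ hrat htype hiso

/-- **The instance at any orientation family from the item** (Poincaré duality supplied by
`OrientationFamily.hasPoincareDuality`). [cite: Buskin2019, Thm. 1.1] -/
theorem buskinAt_of_hodgeIsometryAlgebraic (h : Theses.NikulinTwinTransport.HodgeIsometryAlgebraic)
    (μ : OrientationFamily) : BuskinAt[μ] :=
  fun S S' hS hS' p p' hp hp' φ hrat htype hiso =>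
    h μ μ.hasPoincareDuality S S' hS hS' p p' hp hp' φ hrat htype hiso

/-- **The item is equivalent to its instance at any single orientation family `μ₀`, with no
duality hypothesis.** [cite: Buskin2019, Thm. 1.1] [cite: FultonYoungTableaux1997, Appendix B §B.1 (5)] -/
theorem hodgeIsometryAlgebraic_iff_buskinAt (μ₀ : OrientationFamily) :
    Theses.NikulinTwinTransport.HodgeIsometryAlgebraic ↔ BuskinAt[μ₀] :=
  ⟨fun h => buskinAt_of_hodgeIsometryAlgebraic h μ₀, hodgeIsometryAlgebraic_of_buskinAt μ₀⟩

/-! ### Buskin's proof of Thm. 1.1 at one orientation family, from its remaining ingredients -/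

/-- **Buskin's Theorem 1.1 at one orientation family `μ₀`, from the four inputs of its printed
proof** (§6.2, p. 22), the tree's assembly `Buskin2019_hodgeIsometry_algebraic_of_reflective` re-run
at `μ₀` alone: (h) the projective surjectivity of the period map (named fact
`Huybrechts_K3_periodSurjective_projective`); (hmark) markings with projective periods (named fact
`Huybrechts_K3_marking_exists`, Huybrechts Ch. 1 Prop. 3.5); (hrefl) Prop. 6.2 for reflective
isometries `η⁻¹ ∘ s_v ∘ η'` between marked projective K3 surfaces, at `μ₀`; (hcomp) Lemma 6.3,
composition of algebraic correspondences between K3 surfaces, at `μ₀`. Proof as printed: the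
generators of `H⁴` of the statement are those of the markings up to signs, opposite signs being
impossible (`not_antiIsometry_k3Form`); `σ = η ∘ φ ∘ η'⁻¹` is a rational isometry of `Λ_ℚ`, a product
of reflections along non-isotropic lattice vectors (`exists_eq_prod_k3ReflectionC`, an empty product
rewritten `s_u ∘ s_u`); `σ` carries the period of `(S', η')` into the period line of `(S, η)` since `φ`
preserves type `(2,0)`; `corr_prod_k3ReflectionC_of_reflective` composes the chain.
[cite: Buskin2019, §6.2, proof of Thm. 1.1, Prop. 6.2 and Lemma 6.3] [cite: Huybrechts2019, §1.1]
[cite: Huybrechts2016K3, Ch. 1 Prop. 3.5] -/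
theorem buskinAt_of_reflective (μ₀ : OrientationFamily)
    (h : Huybrechts_K3_periodSurjective_projective) (hmark : Huybrechts_K3_marking_exists)
    (hrefl : ∀ (S S' : SchemeOver ℂ) (hS : IsK3Surface S) (hS' : IsK3Surface S')
      (η : complexBetti S (2 * 1) ≃ₗ[ℂ] (K3Index → ℂ)) (p : complexBetti S (2 * 2)) (x : K3Index → ℂ)
      (η' : complexBetti S' (2 * 1) ≃ₗ[ℂ] (K3Index → ℂ)) (p' : complexBetti S' (2 * 2))
      (x' : K3Index → ℂ),
      MarkedK3[S, η, p, x] → PeriodPt[x] → MarkedK3[S', η', p', x'] → PeriodPt[x'] →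
      ∀ v : K3Index → ℤ, ∑ i, ∑ j, v i * k3Gram i j * v j ≠ 0 →
      (∃ t : ℂ, k3ReflectionC v x' = t • x) →
      ∃ γ ∈ algebraicClasses (S ⊗ S') 2, ∀ y : complexBetti S' (2 * 1),
        η.symm (k3ReflectionC v (η' y)) = Corr[μ₀, S, S', hS, hS' ; γ, y])
    (hcomp : ∀ (S S' S'' : SchemeOver ℂ) (hS : IsK3Surface S) (hS' : IsK3Surface S')
      (hS'' : IsK3Surface S''),
      ∀ γ ∈ algebraicClasses (S ⊗ S') 2, ∀ γ' ∈ algebraicClasses (S' ⊗ S'') 2,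
      ∃ γ'' ∈ algebraicClasses (S ⊗ S'') 2, ∀ y : complexBetti S'' (2 * 1),
        Corr[μ₀, S, S'', hS, hS'' ; γ'', y] =
          Corr[μ₀, S, S', hS, hS' ; γ, Corr[μ₀, S', S'', hS', hS'' ; γ', y]]) :
    BuskinAt[μ₀] := by
  -- adapted from `Literature.AlgebraicGeometry.Surfaces.Buskin2019_hodgeIsometry_algebraic_of_reflective`
  intro S S' hS hS' p p' hp hp' φ hrat htype hiso
  obtain ⟨η, p₀, x, hp₀, hm, hx⟩ := hmark S hS
  obtain ⟨η', p₀', x', hp₀', hm', hx'⟩ := hmark S' hS'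
  -- the generators of `H⁴` of the statement are those of the markings up to sign
  have hsg : p = p₀ ∨ p = -p₀ := eq_or_eq_neg_of_zsmul hp₀ (hp.2 p₀ hm.1) (hm.2.1 p hp.1)
  have hsg' : p' = p₀' ∨ p' = -p₀' := eq_or_eq_neg_of_zsmul hp₀' (hp'.2 p₀' hm'.1) (hm'.2.1 p' hp'.1)
  obtain ⟨s, hs, hs1⟩ : ∃ s : ℂ, p = s • p₀ ∧ (s = 1 ∨ s = -1) := by
    rcases hsg with hsg | hsg
    · exact ⟨1, by rw [hsg, one_smul], Or.inl rfl⟩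
    · exact ⟨-1, by rw [hsg, neg_one_smul], Or.inr rfl⟩
  obtain ⟨s', hs', hs1'⟩ : ∃ s' : ℂ, p₀' = s' • p' ∧ (s' = 1 ∨ s' = -1) := by
    rcases hsg' with hsg' | hsg'
    · exact ⟨1, by rw [hsg', one_smul], Or.inl rfl⟩
    · exact ⟨-1, by rw [hsg', smul_neg, neg_one_smul, neg_neg], Or.inr rfl⟩
  -- the isometry `σ = η ∘ φ ∘ η'⁻¹` of `Λ_ℚ`
  set σ : Module.End ℂ (K3Index → ℂ) := η.toLinearMap ∘ₗ φ ∘ₗ η'.symm.toLinearMap with hσdef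
  have hσrat : ∀ v : K3Index → ℤ, ∃ w : K3Index → ℚ, σ (fun i => (v i : ℂ)) = fun i => (w i : ℂ) :=
    markingConj_intCast hS η hm.2.2.1 η' hm'.2.2.1 φ hrat
  have hσform : ∀ a b, k3Form (σ a) (σ b) = s' * s * k3Form a b :=
    k3Form_markingConj_signed η p₀ p hp₀ s hs hm.2.2.2.1 η' p₀' p' s' hs' hm'.2.2.2.1 φ hiso
  -- opposite signs would make `σ` an anti-isometry of `Λ_ℚ`, which does not exist
  have hss : s' * s = 1 := by
    rcases hs1 with rfl | rfl <;> rcases hs1' with rfl | rfl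
    · norm_num
    · exact (not_antiIsometry_k3Form σ (fun a b => by rw [hσform]; ring) hσrat).elim
    · exact (not_antiIsometry_k3Form σ (fun a b => by rw [hσform]; ring) hσrat).elim
    · norm_num
  have hσiso : ∀ a b, k3Form (σ a) (σ b) = k3Form a b := fun a b => by
    rw [hσform, hss, one_mul]
  -- Cartan–Dieudonné: `σ` is a product of reflections along non-isotropic lattice vectors
  obtain ⟨l, hl, -, hσl⟩ := exists_eq_prod_k3ReflectionC σ hσiso hσrat
  -- make the list non-empty (`1 = s_u ∘ s_u` for the positive lattice vector `u ∈ x'^⊥`)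
  obtain ⟨u, -, hu⟩ := hx'.2.2
  obtain ⟨lne, hlne0, hlne, hσlne⟩ : ∃ lne : List (K3Index → ℤ), lne ≠ [] ∧
      (∀ v ∈ lne, ∑ i, ∑ j, v i * k3Gram i j * v j ≠ 0) ∧ σ = (lne.map k3ReflectionC).prod := by
    cases l with
    | nil =>
      refine ⟨[u, u], List.cons_ne_nil _ _, fun v hv => ?_, ?_⟩
      · simp only [List.mem_cons, List.not_mem_nil, or_false, or_self] at hv
        rw [hv]
        exact hu.ne'
      · rw [hσl]
        simp [k3ReflectionC_mul_self]
    | cons v l => exact ⟨v :: l, List.cons_ne_nil _ _, hl, hσl⟩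
  -- `σ` carries the period of `(S', η')` into the period line of `(S, η)`: `φ` preserves `(2,0)`
  have hper : ∃ t : ℂ, (lne.map k3ReflectionC).prod x' = t • x := by
    have h20 : IsOfHodgeType 2 S (2 * 1) 2 0 (φ (η'.symm x')) := htype 2 0 _ hm'.2.2.2.2.1
    obtain ⟨t, ht⟩ := hm.2.2.2.2.2 _ h20
    refine ⟨t, ?_⟩
    rw [← hσlne, hσdef]
    simp only [LinearMap.coe_comp, LinearEquiv.coe_coe, Function.comp_apply]
    rw [ht, map_smul, LinearEquiv.apply_symm_apply]
  -- the chain of marked K3 surfaces and the composition of the reflective correspondences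
  obtain ⟨γ, hγ, hγeq⟩ := corr_prod_k3ReflectionC_of_reflective μ₀ h hrefl hcomp lne hlne0
    hlne hS' η' p₀' x' hm' hx' hS η p₀ x hm hx hper
  refine ⟨γ, hγ, fun y => ?_⟩
  rw [← hγeq, ← hσlne, hσdef]
  simp only [LinearMap.coe_comp, LinearEquiv.coe_coe, Function.comp_apply,
    LinearEquiv.symm_apply_apply]

/-- **What the item `HodgeIsometryAlgebraic` (stmt-HodgeConjecture-13675) hinges on, by name**:
granted the two named facts `Huybrechts_K3_periodSurjective_projective` (surjectivity of the period
map, projective form) and `Huybrechts_K3_marking_exists` (markings of K3 surfaces), Buskin's Prop. 6.2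
for reflective isometries (`hrefl`) and his Lemma 6.3 on the composition of algebraic correspondences
(`hcomp`) — both required at ONE orientation family `μ₀` only — the item follows for every
orientation family. Conditional: (hrefl) is the unformalised heart of Buskin's paper, (hcomp) is
formal debt. [cite: Buskin2019, Thm. 1.1 and §6.2 (Prop. 6.2, Lemma 6.3)] [cite: Huybrechts2019, §1.1]
[cite: Huybrechts2016K3, Ch. 1 Prop. 3.5] -/
theorem hodgeIsometryAlgebraic_of_reflective (μ₀ : OrientationFamily)
    (h : Huybrechts_K3_periodSurjective_projective) (hmark : Huybrechts_K3_marking_exists)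
    (hrefl : ∀ (S S' : SchemeOver ℂ) (hS : IsK3Surface S) (hS' : IsK3Surface S')
      (η : complexBetti S (2 * 1) ≃ₗ[ℂ] (K3Index → ℂ)) (p : complexBetti S (2 * 2)) (x : K3Index → ℂ)
      (η' : complexBetti S' (2 * 1) ≃ₗ[ℂ] (K3Index → ℂ)) (p' : complexBetti S' (2 * 2))
      (x' : K3Index → ℂ),
      MarkedK3[S, η, p, x] → PeriodPt[x] → MarkedK3[S', η', p', x'] → PeriodPt[x'] →
      ∀ v : K3Index → ℤ, ∑ i, ∑ j, v i * k3Gram i j * v j ≠ 0 →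
      (∃ t : ℂ, k3ReflectionC v x' = t • x) →
      ∃ γ ∈ algebraicClasses (S ⊗ S') 2, ∀ y : complexBetti S' (2 * 1),
        η.symm (k3ReflectionC v (η' y)) = Corr[μ₀, S, S', hS, hS' ; γ, y])
    (hcomp : ∀ (S S' S'' : SchemeOver ℂ) (hS : IsK3Surface S) (hS' : IsK3Surface S')
      (hS'' : IsK3Surface S''),
      ∀ γ ∈ algebraicClasses (S ⊗ S') 2, ∀ γ' ∈ algebraicClasses (S' ⊗ S'') 2,
      ∃ γ'' ∈ algebraicClasses (S ⊗ S'') 2, ∀ y : complexBetti S'' (2 * 1),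
        Corr[μ₀, S, S'', hS, hS'' ; γ'', y] =
          Corr[μ₀, S, S', hS, hS' ; γ, Corr[μ₀, S', S'', hS', hS'' ; γ', y]]) :
    Theses.NikulinTwinTransport.HodgeIsometryAlgebraic :=
  hodgeIsometryAlgebraic_of_buskinAt μ₀ (buskinAt_of_reflective μ₀ h hmark hrefl hcomp)

/-! ### The item, conditionally on the named fact -/

/-- **The route item `HodgeIsometryAlgebraic`, CONDITIONAL on the named fact
`Buskin2019_hodgeIsometry_algebraic`** (Buskin 2019, Thm. 1.1 = Huybrechts 2019, Thm. 0.2: every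
Hodge isometry `H²(S′, ℚ) ⥲ H²(S, ℚ)` between projective K3 surfaces is induced by an algebraic class
on `S × S′`). The item is the fact's body verbatim (`hodgeIsometryAlgebraic_iff_buskin`), so this is
the honest form of the closing theorem until `Buskin2019_hodgeIsometry_algebraic_holds` lands; its
discharge path inside the tree is `hodgeIsometryAlgebraic_of_reflective` /
`Buskin2019_hodgeIsometry_algebraic_of_reflective_at` (period surjectivity, markings, Prop. 6.2,
Lemma 6.3). [cite: Buskin2019, Thm. 1.1] [cite: Huybrechts2019, Thm. 0.2] -/
theorem hodgeIsometryAlgebraic_of_buskin (hB : Buskin2019_hodgeIsometry_algebraic) :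
    Theses.NikulinTwinTransport.HodgeIsometryAlgebraic :=
  hodgeIsometryAlgebraic_iff_buskin.2 hB

end Summit.HodgeConjecture.HodgeConjecture.Theorems.NikulinTwinTransport

end
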